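import Literature.AlgebraicGeometry.Frobenioids.UnitTrivializationIsFrobenioid
import Literature.AlgebraicGeometry.Frobenioids.IsoSubanchorNotIsotropic
import Literature.AlgebraicGeometry.Frobenioids.BaseCategoryTheoreticityDefs
import HarnessLib

/-!
# Frobenioids I, Proposition 5.5 (iii), "Finally" — the unit-trivialisation half: `C` of standard type
# and not of group-like type ⇒ `C^un-tr` of standard type (PROVED, over THE `untrFunctor`)

Mochizuki, *The geometry of Frobenioids I: the general theory*, Kyushu J. Math. **62** (2008)
293–400, §5, Proposition 5.5 (iii) p. 104 ll. 37–39: "Finally, suppose further that `C` is not of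
group-like type. Then if `C` is of standard (respectively, rationally standard) type, then so are
`C^un-tr`, `C^rlf`"; proof p. 105 ll. 22–27: "Now suppose that `C`, hence also `C^un-tr`, `C^rlf`, are
not of group-like type. … In light of these observations, it follows immediately from the definitions
that if `C` is of standard … type, then so are `C^un-tr`, `C^rlf`." [cite: MochizukiFrdI2008, Prop. 5.5 (iii) p.104]

Proof-only companion (cell abc-iut, sub-DAG S7 row `FrdI:Prop5.5(iii)/P55-L07`, standard /
unit-trivialisation half; seat abc-iut-w4-d084) over THE unit-trivialisation of a Frobenioid
`F : C → F_Φ`: the quotient `C^un-tr = (ofFunctor Φ F).Untr` of `C^istr` by unit-equivalence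
(Def. 3.1 (iv), seat abc-iut-L1-t3) with ITS structure functor `untrFunctor hF : C^un-tr → F_Φ`
(Prop. 3.3 (iv), seat abc-iut-L1-d5; a Frobenioid of isotropic, unit-trivial type:
`isFrobenioid_untr`, `isOfIsotropicType_untr`). We go clause by clause through Def. 3.1 (i)
(`PreFrobenioidData.IsOfStandardType`), exactly as the tree does for `C^istr` in
`IstrStandardTypeProofs.lean` (Remark 4.5.1): (a) quasi-isotropic — every object of `C^un-tr` is
isotropic and `C^un-tr` has no iso-subanchors (Remark 3.1.1 for the Frobenioid `C^un-tr`);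
Frobenius-isotropic (every object is isotropic and its identity is of Frobenius type, every arrow of
`C^un-tr` being co-angular); (b) holds vacuously: `C^un-tr` of group-like type would force `C` of
group-like type (`Φ(Base A) ≅ Φ(Base A₁)` along an isotropic hull `A → A₁`, Def. 1.3 (vii)(a), and
`A₁ ∈ Ob(C^un-tr)`), contrary to the hypothesis; (c) Frobenius-normalized — an equation between
endomorphisms of `C` at an isotropic object descends to the classes in `C^un-tr` (Prop. 3.3 (iv):
`deg_Fr`, `Base`, `O^▷` of a class are those of any representative); (d), (e) concern `D` and `Φ`
only, which `C^un-tr → F_Φ` shares with `C → F_Φ`. Main theorem: `isOfStandardType_untr`; it is the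
`C^un-tr` conjunct of `FrdI.Prop55Sub.Prop55iii_untr_rlf_standard` (statements file
`Prop55Sub.lean`); the `C^rlf` conjunct (Thm. 5.2 (iii) at the realified data) is not treated here.
No statement of the paper is strengthened; nothing here bears on [IUTchIII] Cor. 3.12.
-/

namespace Literature.AlgebraicGeometry.Frobenioids

open CategoryTheory Opposite

universe w v v' u u'

namespace PreFrobenioid

variable {D : Type u} [Category.{v} D] {Φ : Dᵒᵖ ⥤ CommMonCat.{w}} {C : Type u'}
  [Category.{v'} C] {F : C ⥤ ElemFrobenioid Φ}

open PreFrobenioidData (ofFunctor)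

/-! ### The objects of `C^un-tr` in the operations vocabulary -/

/-- Every object of `C^un-tr` is isotropic for the operations of `untrFunctor hF` (Prop. 3.3 (iv):
"`C^un-tr` is of isotropic … type"). [cite: MochizukiFrdI2008, Prop. 3.3 (iv) p.60] -/
theorem isIsotropic_untrData (hF : IsFrobenioid F) (A : (ofFunctor Φ F).Untr) :
    (ofFunctor Φ (untrFunctor hF)).IsIsotropic A :=
  (PreFrobenioidData.ofFunctor_isIsotropic (untrFunctor hF) A).mpr (isOfIsotropicType_untr hF A)

/-- The identity of an object of `C^un-tr` is of Frobenius type (an isometric base-isomorphism; every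
arrow of `C^un-tr` is co-angular). [cite: MochizukiFrdI2008, Prop. 3.3 (iv) p.60] -/
theorem isFrobeniusType_id_untrData (hF : IsFrobenioid F) (A : (ofFunctor Φ F).Untr) :
    (ofFunctor Φ (untrFunctor hF)).IsFrobeniusType (𝟙 A) := by
  refine (PreFrobenioidData.ofFunctor_isFrobeniusType (untrFunctor hF) (𝟙 A)).mpr ⟨⟨isCoAngular_untr hF _, ?_⟩, ?_⟩
  · exact div_id (untrFunctor hF) A
  · change IsIso (Base (untrFunctor hF) (𝟙 A))
    rw [base_id]
    infer_instance

/-- `C^un-tr` (of a Frobenioid) has no iso-subanchors: Remark 3.1.1 for the Frobenioid `C^un-tr → F_Φ`,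
which is of isotropic type. [cite: MochizukiFrdI2008, Rem. 3.1.1 p.57] -/
theorem not_isIsoSubanchor_untrData (hF : IsFrobenioid F) (A : (ofFunctor Φ F).Untr) :
    ¬ IsIsoSubanchor A :=
  not_isIsoSubanchor_of_isOfIsotropicType (isFrobenioid_untr hF) (isOfIsotropicType_untr hF) A

/-- If `C^un-tr` is of group-like type then so is `C`: every `X ∈ Ob(C)` has an isotropic hull
`X → X₁` (Def. 1.3 (vii)(a)), a base-isomorphism, so `Φ(Base X) ≅ Φ(Base X₁)`, and `X₁` is an object
of `C^un-tr` with `Base` computed in `C`. [cite: MochizukiFrdI2008, Def. 1.3 (vii) p.24] -/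
theorem isOfGroupLikeType_of_untrData (hF : IsFrobenioid F)
    (h : (ofFunctor Φ (untrFunctor hF)).IsOfGroupLikeType) :
    (ofFunctor Φ F).IsOfGroupLikeType := by
  refine ⟨fun X x => ?_⟩
  obtain ⟨X₁, k, hk⟩ := hF.vii_a X
  have hX₁ : (ofFunctor Φ F).IsIsotropic X₁ :=
    (PreFrobenioidData.ofFunctor_isIsotropic F X₁).mpr hk.2.2.1
  haveI : IsIso ((ofFunctor Φ F).base.map k) := hk.2.1.2
  -- `X₁` as an object of `C^un-tr`; its divisor monoid is `Φ(Base X₁)`, computed in `C`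
  have h1 : (ofFunctor Φ F).pull (inv ((ofFunctor Φ F).base.map k)) x = 1 :=
    h.obj ((ofFunctor Φ F).toUntr.obj ⟨X₁, hX₁⟩) _
  calc x = (ofFunctor Φ F).pull (𝟙 _) x := ((ofFunctor Φ F).pull_id _ x).symm
    _ = (ofFunctor Φ F).pull ((ofFunctor Φ F).base.map k ≫ inv ((ofFunctor Φ F).base.map k)) x := by
          rw [IsIso.hom_inv_id]
    _ = (ofFunctor Φ F).pull ((ofFunctor Φ F).base.map k)
          ((ofFunctor Φ F).pull (inv ((ofFunctor Φ F).base.map k)) x) :=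
          (ofFunctor Φ F).pull_comp _ _ x
    _ = 1 := by rw [h1, map_one]

/-- A Frobenius-normalized isotropic object of `C` gives a Frobenius-normalized object of `C^un-tr`:
a base-identity endomorphism `φ = [f]` and `α = [a] ∈ O^▷` of the class have representatives `f`
base-identity of the same Frobenius degree and `a ∈ O^▷(A)` (Prop. 3.3 (iv): the invariants of a class
are those of any representative), and the equation `a^d ∘ f = f ∘ a` of `C` (Def. 1.2 (iv)) descends
along the functor `C^istr → C^un-tr`. [cite: MochizukiFrdI2008, Prop. 3.3 (iv) p.60] -/
theorem isFrobeniusNormalized_untrData (hF : IsFrobenioid F) (A : (ofFunctor Φ F).Untr)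
    (h : (ofFunctor Φ F).IsFrobeniusNormalized A.as.obj) :
    (ofFunctor Φ (untrFunctor hF)).IsFrobeniusNormalized A := by
  intro φ hφ α hα
  obtain ⟨f, hf⟩ : ∃ f : End A.as, (ofFunctor Φ F).toUntr.map f = φ :=
    (ofFunctor Φ F).toUntr.map_surjective φ
  obtain ⟨a, ha⟩ : ∃ a : End A.as, (ofFunctor Φ F).toUntr.map a = α :=
    (ofFunctor Φ F).toUntr.map_surjective α
  -- the invariants of the classes are those of the representatives
  have hf' : (ofFunctor Φ F).IsBaseIdentity f.hom := by
    have e := hφ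
    rw [← hf] at e
    exact e
  have ha' : a.hom ∈ (ofFunctor Φ F).endSubmonoid A.as.obj := by
    have e := hα
    rw [← ha] at e
    exact e
  have hdeg : (ofFunctor Φ (untrFunctor hF)).degFr φ = (ofFunctor Φ F).degFr f.hom := by
    rw [← hf]; rfl
  -- the printed equation in `C`, transported to `End A.as` (full subcategory) and then to `C^un-tr`
  have hC := h f.hom hf' a.hom ha'
  let ι : End A.as →* End A.as.obj :=
    { toFun := fun b => b.hom, map_one' := rfl, map_mul' := fun _ _ => rfl }
  have hι : Function.Injective ι := fun b b' hbb' => ObjectProperty.hom_ext _ hbb'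
  have hIstr : a ^ ((ofFunctor Φ F).degFr f.hom : ℕ) * f = f * a := by
    apply hι
    rw [map_mul, map_mul, map_pow]
    exact hC
  have hmap := congrArg ((ofFunctor Φ F).toUntr.mapEnd A.as) hIstr
  rw [map_mul, map_mul, map_pow] at hmap
  have hmf : (ofFunctor Φ F).toUntr.mapEnd A.as f = φ := hf
  have hma : (ofFunctor Φ F).toUntr.mapEnd A.as a = α := ha
  rw [hmf, hma] at hmap
  rw [hdeg]
  exact hmap

/-! ### Proposition 5.5 (iii), "Finally": the unit-trivialisation half -/

/-- **Proposition 5.5 (iii), "Finally" — `C^un-tr` half (PROVED)**: for a Frobenioid `C → F_Φ` that is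
NOT of group-like type, if `C` is of standard type then so is `C^un-tr` (with respect to its structure
functor `untrFunctor hF : C^un-tr → F_Φ` of Prop. 3.3 (iv)) — clause by clause of Def. 3.1 (i):
quasi-isotropic (all objects isotropic, no iso-subanchors: Rem. 3.1.1 for the Frobenioid `C^un-tr`),
Frobenius-isotropic (identities are of Frobenius type), (b) vacuous (`C^un-tr` group-like would force
`C` group-like via isotropic hulls), Frobenius-normalized (descends from `C`), (d)(e) unchanged
(FrdI p. 105 ll. 22–27: "it follows immediately from the definitions").
[cite: MochizukiFrdI2008, Prop. 5.5 (iii) p.104] -/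
theorem isOfStandardType_untr (hF : IsFrobenioid F) (hng : ¬ (ofFunctor Φ F).IsOfGroupLikeType)
    (hS : (ofFunctor Φ F).IsOfStandardType) :
    (ofFunctor Φ (untrFunctor hF)).IsOfStandardType where
  quasiIsotropic := ⟨fun A => ⟨fun h => (h (isIsotropic_untrData hF A)).elim,
    fun h => (not_isIsoSubanchor_untrData hF A h).elim⟩⟩
  frobeniusIsotropic := ⟨fun A => ⟨A, 𝟙 A, isFrobeniusType_id_untrData hF A, isIsotropic_untrData hF A⟩⟩
  frobeniusCompact_of_groupLike := fun hGL => (hng (isOfGroupLikeType_of_untrData hF hGL)).elim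
  frobeniusNormalized := ⟨fun A =>
    isFrobeniusNormalized_untrData hF A (hS.frobeniusNormalized.obj A.as.obj)⟩
  fsmff := hS.fsmff
  nonDilating := ⟨hS.nonDilating.nonDilating⟩

/-- The same with "not of group-like type" in the form used by the statements file `Prop55Sub.lean`
(`¬ IsOfType (IsGroupLikeObj F)`, found's functor-level predicate).
[cite: MochizukiFrdI2008, Prop. 5.5 (iii) p.104] -/
theorem isOfStandardType_untr' (hF : IsFrobenioid F) (hng : ¬ IsOfType (IsGroupLikeObj F))
    (hS : (ofFunctor Φ F).IsOfStandardType) :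
    (ofFunctor Φ (untrFunctor hF)).IsOfStandardType :=
  isOfStandardType_untr hF (fun h => hng fun A => (PreFrobenioidData.ofFunctor_isGroupLikeObj F A).mp (h.obj A)) hS

end PreFrobenioid

end Literature.AlgebraicGeometry.Frobenioids
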